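import Summits.HodgeConjecture.HodgeConjecture.Theorems.Ring2AbelianAllEvenTimesEvenComponents
import Literature.AlgebraicGeometry.HodgeTheory.WeilTypeProducts
import Literature.AlgebraicGeometry.HodgeTheory.WeilClassesProductsOfFactors
import Literature.AlgebraicGeometry.HodgeTheory.WeilClassesFourfolds
import Literature.AlgebraicGeometry.HodgeTheory.WeilFourfoldsDiscOnePowers
import HarnessLib

/-!
# Ring 2 · Weil-type family-coverage census (ring2-b05, gen 57) — the POWERS COLUMN in the kernel:
  `A^{k+1}` lies on the component of class `δ^{k+1}`; odd powers keep the class, even powers are split;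
  the Weil classes of every power are algebraic as soon as those of `A` are

research route conditional on HC_CM; not a corollary; Q11.4-sentence-2 already refuted in dim ≥ 3.
`HC_CM` (`Theses.RankFourFaces.CMAbelianHodge`, by name) does not occur in this file; no case of the Hodge conjecture is
claimed. Cell `pub-hodge-ring2`, seat `ring2-b05` (census section «## b05 (g ≥ 8 / powers)» of `WEIL-FAMILY-COVERAGE.md`,
block b05.2 «THE POWERS COLUMN», sentences (S2)(i)–(ii) as quoted by the consumer). No definition, no named fact, no `sorry`.

The census indexes the components of the polarised Weil-type locus by `(n, K = ℚ(√-d), δ)` — the cell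
`Ring2.Hypotheses.WeilClassesComponent n d δ`: abelian `2n`-folds `(A, φ)`, `φ ≫ φ = -(d • 𝟙 A)`, carrying a `K`-symmetrised
hyperplane class `h_K = d·e^*a + φ^*e^*a` (`e` a projective embedding, `a ≠ 0` a rational ambient class) of NON-DEGENERATE
discriminant class `det H = δ ∈ ℚˣ/Nm(Kˣ)` (`VanGeemen1994.HasWeilDiscriminantNondeg`, van Geemen Lemma 5.2 (2)–(3)). Its
POWERS column records where the powers `A^{k+1} = A.powSucc k` (diagonal action `powSuccMap φ k`, product polarisation) of
the members of a component lie, and what is known about their Weil classes. This file proves the column's bookkeeping ON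
THE CARRIERS, for every `n ≥ 1`, `d ≥ 1`, `δ`, `k`:

* §1 `exists_ksymm_hasWeilDiscriminantNondeg_powSucc` — **MEMBERSHIP: `A^{k+1}` carries a `K`-symmetrised (Segre)
  hyperplane class of non-degenerate class `δ^{k+1}`** (induction on `k` over the COMPONENT MULTIPLICATION LAW
  `Ring2.AbelianAll.exists_ksymm_hasWeilDiscriminantNondeg_prod` of seat ab-weil-2, i.e. ab-weil-1's "det H is
  multiplicative" `hasWeilDiscriminantNondeg_prod` on the Segre embedding of the given embeddings; `A.powSucc (k+1) =
  A.powSucc k × A` and `powSuccMap φ (k+1) = (powSuccMap φ k) × φ`, `HodgeTheory.powSuccMap_succ_eq_powPair`).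
* §2 PARITY (`δ² = 1` in `ℚˣ/Nm(Kˣ)`, `Ring2.AbelianAll.weilNormResidueGroup_mul_self`): `δ^{k+1} = δ` for `k` even and
  `= 1 = [(-1)^{(k+1)n}]` for `k` odd — **ODD powers lie on the component of `A`, EVEN powers on the SPLIT component**
  (`…_powSucc_of_even`, `…_powSucc_of_odd`); for a Weil-type pair every EVEN power is of SPLIT Weil type
  (`isSplitWeilType_powSucc_of_odd`, Landherr's converse on the carriers `VanGeemen1994.IsWeilType.isSplitWeilType_of_…`),
  and on a NON-split component the product polarisation of every ODD power is NOT hyperbolic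
  (`exists_ksymm_not_isHyperbolicWeilType_powSucc_of_even`; this does not make the odd power non-split — other
  polarisations of `A^{k+1}` may have other classes, cf. `Ring2AbelianAllEvenTimesEvenComponents` §2).
* §3 `weilClassesOf_powSucc_le_algebraicClasses` — **`W_K(A^{k+1}) ⊗ ℂ ⊆ N^{(k+1)n}` as soon as `W_K(A) ⊗ ℂ ⊆ Nⁿ`**
  (Schoen's product step iterated, `HodgeTheory.weilClassesOf_prod_le_algebraicClasses`; no hypothesis on `A` beyond
  `dim A = 2n`, `φ² = -d`); hence `weilClassesOf_powSucc_le_algebraicClasses_of_weilClassesComponent`: **the cell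
  `WeilClassesComponent n d δ` ALONE makes the Weil classes of EVERY power of EVERY Weil-type member of `(n, d, δ)`
  algebraic** — the powers column adds no open input at the level of Weil classes (census b05.2: «W_K(Aᵏ) ⟸ W_K(A)»).

* §4 EVEN POWERS FEED ON THE SPLIT RUNGS ONLY: granted R2₈ `WeilTypeLadder.SplitEightfolds` (binder) the square of EVERY
  Weil-type FOURFOLD of ANY class has algebraic Weil classes (`weilClassesOf_sq_fourfold_le_algebraicClasses_of_splitEightfolds`);
  granted R2 `WeilTypeLadder.SplitWeilAbelianVarieties` (binder) every EVEN power of every Weil-type member of every row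
  (`n ≥ 2`) does (`weilClassesOf_powSucc_le_algebraicClasses_of_splitWeilAbelianVarieties`).

* §5 FOURFOLDS BY NAME: modulo the named fact `Markman2025_weilClasses_algebraic_abelianFourfold` (PREPRINT) the Weil classes
  of EVERY power of EVERY Weil-type fourfold are algebraic (`…_of_markman2025`); modulo the REFEREED fact
  `Markman2023_weilClasses_algebraic_discOneWeilFourfold` those of every power of every SPLIT Weil fourfold (`…_of_markman2023`).

NOT CLAIMED: anything about the FULL Hodge ring of `A^{k+1}` (the general-member power cell
`Ring2.Hypotheses.HodgePowersOfGeneralWeilTypeComponent` is `Ring2HypothesesWeilPowers` / `…GeneralDischarged`, modulo the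
typed print input PW0 = Abdulali); that `A^{k+1}` is NON-split when `A` is (false in general: `det H` depends on the
polarisation); any arrow from a power back to `A`.

## References
* [vanGeemen1994HodgeAV] B. van Geemen, LNM 1594 (1994), 4.9, 4.14, Lemma 5.2 (2)–(4), 5.4 and (5.4.1), Thm. 6.12.
* [MoonenZarhin1999LowDim] B. Moonen, Yu. Zarhin, Math. Ann. 315 (1999), (1.9) (`W_K(X₁ × X₂) = W_K(X₁) ⊗_K W_K(X₂)`).
* [Markman2025SurveySecant] E. Markman, arXiv:2509.23403, §11.5 Step 2 (preprint; the one printed sentence on `det H` of a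
  product).
* [Schoen1998HodgeWeilAddendum] C. Schoen, Compositio Math. 114 (1998), §10.
* [Landherr1936HermitianForms] W. Landherr, Abh. Math. Sem. Hamburg 11 (1936).
* [Markman2025SecantWeil] E. Markman, arXiv:2502.03415, Cor. 1.6.1 (preprint). [Markman2023GeneralizedKummers] E. Markman,
  JEMS 25 (2023), Thm. 1.5. [FloccariFu2026] S. Floccari, L. Fu, JMPA 210 (2026) 103876, Thm. 1.2.
-/

set_option linter.dupNamespace false -- `Summit.HodgeConjecture.HodgeConjecture.…` (summit = problem) trips it

noncomputable section

open CategoryTheory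

namespace Summit.HodgeConjecture.HodgeConjecture.Ring2.WeilCoverage

open Literature.AlgebraicGeometry Literature.AlgebraicGeometry.Motives
open Literature.AlgebraicGeometry.HodgeTheory Literature.AlgebraicGeometry.VanGeemen1994
open Literature.AlgebraicTopology.SingularHomology
open Summit.HodgeConjecture.HodgeConjecture.Ring2.Hypotheses
open Summit.HodgeConjecture.HodgeConjecture.Ring2.AbelianAll

variable {A : AbelianVariety ℂ} {φ : A ⟶ A} {n d : ℕ}

/-! ## §0 The power `(A^{k+1}, φ^{k+1})`: dimension and `(φ^{k+1})² = -d` -/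

/-- `dim A^{k+1} = 2·(k+1)·n` when `dim A = 2n` (`A.powSucc (k+1) = A.powSucc k × A`). [folklore] -/
theorem dim_powSucc_eq_two_mul (hA : A.dim = 2 * n) : ∀ k : ℕ, (A.powSucc k).dim = 2 * ((k + 1) * n)
  | 0 => by rw [AbelianVariety.powSucc_zero, Nat.zero_add, one_mul, hA]
  | k + 1 => by
    rw [AbelianVariety.powSucc_succ, AbelianVariety.dim_prod, dim_powSucc_eq_two_mul hA k, hA]
    ring

/-- `(φ^{k+1})² = -d` on `A^{k+1}` when `φ² = -d` (componentwise; `φ^{k+2} = (φ^{k+1}, φ)`).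
[cite: MoonenZarhin1999LowDim, (1.9)] -/
theorem powSuccMap_comp_self_eq_neg (hφ : φ ≫ φ = -(d • 𝟙 A)) :
    ∀ k : ℕ, powSuccMap φ k ≫ powSuccMap φ k = -(d • 𝟙 (A.powSucc k))
  | 0 => by rw [powSuccMap_zero_eq]; exact hφ
  | k + 1 => by
    rw [powSuccMap_succ_eq_powPair]
    exact prodLift_comp_self_eq_neg (powSuccMap_comp_self_eq_neg hφ k) hφ

/-! ## §1 Membership: `A^{k+1}` carries a `K`-symmetrised hyperplane class of class `δ^{k+1}` -/

/-- **POWERS CARRY THE POWER CLASS.** Let `(A, φ)` be a complex abelian `2n`-fold (`n ≥ 1`) with `φ ≫ φ = -(d • 𝟙 A)`,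
`d ≥ 1`, and let the `K`-symmetrised hyperplane class `d·e^*a + φ^*e^*a` of a projective embedding `e` and a rational ambient
class `a ≠ 0` have NON-DEGENERATE discriminant class `δ ∈ ℚˣ/Nm(K_dˣ)`. Then for every `k` the power `A^{k+1} = A.powSucc k`
with the diagonal action `φ^{k+1} = powSuccMap φ k` carries a projective embedding `e'` and a rational ambient class `a' ≠ 0`
whose `K`-symmetrised hyperplane class has non-degenerate discriminant class `δ^{k+1}` (for the half-dimension `(k+1)·n`):
the iterated Segre embedding, "`det H` is multiplicative" (van Geemen Lemma 5.2 (2)–(3) defines `det H`; Markman §11.5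
Step 2 states the product rule; proved on the carriers by `Ring2.AbelianAll.hasWeilDiscriminantNondeg_prod` /
`exists_ksymm_hasWeilDiscriminantNondeg_prod`). No Weil-type hypothesis.
[cite: vanGeemen1994HodgeAV, Lemma 5.2 (2)–(3) and 4.14] [cite: Markman2025SurveySecant, §11.5 Step 2 (preprint)] -/
theorem exists_ksymm_hasWeilDiscriminantNondeg_powSucc (hn : 0 < n) (hd : 0 < d) (hA : A.dim = 2 * n)
    (hφ : φ ≫ φ = -(d • 𝟙 A)) (eA : ProjectiveEmbedding A.X) {aA : complexBetti (projectiveSpace eA.n ℂ) 2}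
    (haA : IsRationalClass aA) (haA0 : aA ≠ 0) {δ : weilNormResidueGroup d}
    (hWA : HasWeilDiscriminantNondeg A φ n d
      ((d : ℂ) • complexBetti.map eA.ι 2 aA + complexBetti.map φ.hom.hom.hom 2 (complexBetti.map eA.ι 2 aA)) δ) :
    ∀ k : ℕ, ∃ (e : ProjectiveEmbedding (A.powSucc k).X) (a : complexBetti (projectiveSpace e.n ℂ) 2),
      IsRationalClass a ∧ a ≠ 0 ∧
      HasWeilDiscriminantNondeg (A.powSucc k) (powSuccMap φ k) ((k + 1) * n) d
        ((d : ℂ) • complexBetti.map e.ι 2 a +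
          complexBetti.map (powSuccMap φ k).hom.hom.hom 2 (complexBetti.map e.ι 2 a)) (δ ^ (k + 1))
  | 0 => by
    refine ⟨eA, aA, haA, haA0, ?_⟩
    rw [powSuccMap_zero_eq, Nat.zero_add, one_mul, pow_one]
    exact hWA
  | k + 1 => by
    obtain ⟨eK, aK, haK, haK0, hWK⟩ := exists_ksymm_hasWeilDiscriminantNondeg_powSucc hn hd hA hφ eA haA haA0 hWA k
    have hkn : 0 < (k + 1) * n := Nat.mul_pos (Nat.succ_pos k) hn
    obtain ⟨e, a, ha, ha0, hP⟩ := exists_ksymm_hasWeilDiscriminantNondeg_prod hkn hn (dim_powSucc_eq_two_mul hA k) hA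
      hd (powSuccMap_comp_self_eq_neg hφ k) hφ eK haK haK0 eA haA haA0 hWK hWA
    refine ⟨e, a, ha, ha0, ?_⟩
    rw [powSuccMap_succ_eq_powPair, show (k + 1 + 1) * n = (k + 1) * n + n by ring, pow_succ]
    exact hP

/-! ## §2 Parity: odd powers keep the class, even powers are split -/

/-- `δ^m = 1` for `m` even: every class of `ℚˣ/Nm(K_dˣ)` is `2`-torsion. [cite: vanGeemen1994HodgeAV, 4.14] -/
theorem weilNormResidueGroup_pow_eq_one_of_even (δ : weilNormResidueGroup d) {m : ℕ} (hm : Even m) : δ ^ m = 1 := by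
  obtain ⟨j, rfl⟩ := hm
  rw [pow_add, ← mul_pow, weilNormResidueGroup_mul_self, one_pow]

/-- `δ^m = δ` for `m` odd. [cite: vanGeemen1994HodgeAV, 4.14] -/
theorem weilNormResidueGroup_pow_eq_self_of_odd (δ : weilNormResidueGroup d) {m : ℕ} (hm : Odd m) : δ ^ m = δ := by
  obtain ⟨j, rfl⟩ := hm
  rw [pow_succ, weilNormResidueGroup_pow_eq_one_of_even δ (even_two_mul j), one_mul]

/-- The split class `[(-1)ᵐ]` is trivial for `m` even. [cite: vanGeemen1994HodgeAV, (5.4.1)] -/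
theorem splitDiscriminantClass_eq_one_of_even {m : ℕ} (hm : Even m) (d : ℕ) : splitDiscriminantClass m d = 1 := by
  rw [splitDiscriminantClass, hm.neg_one_pow, QuotientGroup.mk_one]

/-- **ODD POWERS KEEP THE CLASS**: for `k` even (so `k + 1` odd) the power `A^{k+1}` of a member of the component
`(n, d, δ)` carries a `K`-symmetrised hyperplane class of non-degenerate class `δ` — it lies on the component
`((k+1)n, d, δ)` of the same class (census: "`a(Aᵏ) ≡ aᵏ ≡ a` for `k` odd"; e.g. `X³` on the non-split twelvefold row
of a non-split Weil fourfold `X`). [cite: vanGeemen1994HodgeAV, Lemma 5.2 (2)–(3) and 4.14] -/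
theorem exists_ksymm_hasWeilDiscriminantNondeg_powSucc_of_even (hn : 0 < n) (hd : 0 < d) (hA : A.dim = 2 * n)
    (hφ : φ ≫ φ = -(d • 𝟙 A)) (eA : ProjectiveEmbedding A.X) {aA : complexBetti (projectiveSpace eA.n ℂ) 2}
    (haA : IsRationalClass aA) (haA0 : aA ≠ 0) {δ : weilNormResidueGroup d}
    (hWA : HasWeilDiscriminantNondeg A φ n d
      ((d : ℂ) • complexBetti.map eA.ι 2 aA + complexBetti.map φ.hom.hom.hom 2 (complexBetti.map eA.ι 2 aA)) δ)
    {k : ℕ} (hk : Even k) :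
    ∃ (e : ProjectiveEmbedding (A.powSucc k).X) (a : complexBetti (projectiveSpace e.n ℂ) 2),
      IsRationalClass a ∧ a ≠ 0 ∧
      HasWeilDiscriminantNondeg (A.powSucc k) (powSuccMap φ k) ((k + 1) * n) d
        ((d : ℂ) • complexBetti.map e.ι 2 a +
          complexBetti.map (powSuccMap φ k).hom.hom.hom 2 (complexBetti.map e.ι 2 a)) δ := by
  have h := exists_ksymm_hasWeilDiscriminantNondeg_powSucc hn hd hA hφ eA haA haA0 hWA k
  rwa [weilNormResidueGroup_pow_eq_self_of_odd δ hk.add_one] at h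

/-- **EVEN POWERS ARE ON THE SPLIT COMPONENT**: for `k` odd (so `k + 1` even) the power `A^{k+1}` of a member of ANY
component `(n, d, δ)` carries a `K`-symmetrised hyperplane class of non-degenerate class
`1 = [(-1)^{(k+1)n}] = splitDiscriminantClass ((k+1)n) d` (census: "even powers are split"; e.g. `X²` of a NON-split
Weil fourfold `X` lies on the split eightfold row). [cite: vanGeemen1994HodgeAV, Lemma 5.2 (2)–(3), 4.14 and (5.4.1)] -/
theorem exists_ksymm_hasWeilDiscriminantNondeg_powSucc_of_odd (hn : 0 < n) (hd : 0 < d) (hA : A.dim = 2 * n)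
    (hφ : φ ≫ φ = -(d • 𝟙 A)) (eA : ProjectiveEmbedding A.X) {aA : complexBetti (projectiveSpace eA.n ℂ) 2}
    (haA : IsRationalClass aA) (haA0 : aA ≠ 0) {δ : weilNormResidueGroup d}
    (hWA : HasWeilDiscriminantNondeg A φ n d
      ((d : ℂ) • complexBetti.map eA.ι 2 aA + complexBetti.map φ.hom.hom.hom 2 (complexBetti.map eA.ι 2 aA)) δ)
    {k : ℕ} (hk : Odd k) :
    ∃ (e : ProjectiveEmbedding (A.powSucc k).X) (a : complexBetti (projectiveSpace e.n ℂ) 2),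
      IsRationalClass a ∧ a ≠ 0 ∧
      HasWeilDiscriminantNondeg (A.powSucc k) (powSuccMap φ k) ((k + 1) * n) d
        ((d : ℂ) • complexBetti.map e.ι 2 a +
          complexBetti.map (powSuccMap φ k).hom.hom.hom 2 (complexBetti.map e.ι 2 a))
        (splitDiscriminantClass ((k + 1) * n) d) := by
  have h := exists_ksymm_hasWeilDiscriminantNondeg_powSucc hn hd hA hφ eA haA haA0 hWA k
  rwa [weilNormResidueGroup_pow_eq_one_of_even δ hk.add_one,
    ← splitDiscriminantClass_eq_one_of_even (hk.add_one.mul_right n) d] at h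

/-- **EVERY EVEN POWER OF A WEIL-TYPE PAIR IS OF SPLIT WEIL TYPE.** If `(A, φ)` is of Weil type `(n, d)` and carries
SOME `K`-symmetrised hyperplane class of non-degenerate discriminant (any class `δ`), then for `k` odd the pair
`(A^{k+1}, φ^{k+1})` is of SPLIT Weil type `((k+1)n, d)` (`HodgeTheory.IsSplitWeilType`): it is of Weil type
(`IsWeilType.powSucc`, Moonen–Zarhin (1.9)) and its Segre class has class `[(-1)^{(k+1)n}]`, which is hyperbolic by
Landherr's converse on the carriers (`VanGeemen1994.IsWeilType.isSplitWeilType_of_hasWeilDiscriminantNondeg_split`).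
In particular `X²` of every Weil-type fourfold `X` of any discriminant is a split Weil eightfold.
[cite: vanGeemen1994HodgeAV, Lemma 5.2 (1)–(4), 5.4 and (5.4.1)] [cite: Landherr1936HermitianForms]
[cite: MoonenZarhin1999LowDim, (1.9)] -/
theorem isSplitWeilType_powSucc_of_odd (hW : IsWeilType A φ n d) (eA : ProjectiveEmbedding A.X)
    {aA : complexBetti (projectiveSpace eA.n ℂ) 2} (haA : IsRationalClass aA) (haA0 : aA ≠ 0)
    {δ : weilNormResidueGroup d}
    (hWA : HasWeilDiscriminantNondeg A φ n d
      ((d : ℂ) • complexBetti.map eA.ι 2 aA + complexBetti.map φ.hom.hom.hom 2 (complexBetti.map eA.ι 2 aA)) δ)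
    {k : ℕ} (hk : Odd k) :
    IsSplitWeilType (A.powSucc k) (powSuccMap φ k) ((k + 1) * n) d := by
  obtain ⟨e, a, ha, ha0, h⟩ :=
    exists_ksymm_hasWeilDiscriminantNondeg_powSucc_of_odd hW.pos hW.d_pos hW.dim_eq hW.sq_eq eA haA haA0 hWA hk
  exact VanGeemen1994.IsWeilType.isSplitWeilType_of_hasWeilDiscriminantNondeg_split (hW.powSucc k) e ha ha0 h

/-- **On a NON-split component the product polarisation of every ODD power is NOT hyperbolic.** If the class `δ` of
the member `(A, φ, e, a)` is not the split class `[(-1)ⁿ]`, then for `k` even the `K`-symmetrised Segre class on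
`A^{k+1}` (class `δ` again, §2) is not hyperbolic: `det H` of a `K`-symmetrised hyperplane class is well defined (Lemma
5.2 (3), `VanGeemen1994.not_isHyperbolicWeilType_of_hasWeilDiscriminantNondeg_ne`) and `[(-1)^{(k+1)n}] = [(-1)ⁿ]`. (This
does NOT say that `A^{k+1}` is of non-split Weil type: other polarisations may be hyperbolic.)
[cite: vanGeemen1994HodgeAV, Lemma 5.2 (3), 5.4 and (5.4.1)] -/
theorem exists_ksymm_not_isHyperbolicWeilType_powSucc_of_even (hn : 0 < n) (hd : 0 < d) (hA : A.dim = 2 * n)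
    (hφ : φ ≫ φ = -(d • 𝟙 A)) (eA : ProjectiveEmbedding A.X) {aA : complexBetti (projectiveSpace eA.n ℂ) 2}
    (haA : IsRationalClass aA) (haA0 : aA ≠ 0) {δ : weilNormResidueGroup d}
    (hWA : HasWeilDiscriminantNondeg A φ n d
      ((d : ℂ) • complexBetti.map eA.ι 2 aA + complexBetti.map φ.hom.hom.hom 2 (complexBetti.map eA.ι 2 aA)) δ)
    (hne : δ ≠ splitDiscriminantClass n d) {k : ℕ} (hk : Even k) :
    ∃ (e : ProjectiveEmbedding (A.powSucc k).X) (a : complexBetti (projectiveSpace e.n ℂ) 2),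
      IsRationalClass a ∧ a ≠ 0 ∧
      HasWeilDiscriminantNondeg (A.powSucc k) (powSuccMap φ k) ((k + 1) * n) d
        ((d : ℂ) • complexBetti.map e.ι 2 a +
          complexBetti.map (powSuccMap φ k).hom.hom.hom 2 (complexBetti.map e.ι 2 a)) δ ∧
      ¬ IsHyperbolicWeilType (A.powSucc k) (powSuccMap φ k) ((k + 1) * n)
        ((d : ℂ) • complexBetti.map e.ι 2 a +
          complexBetti.map (powSuccMap φ k).hom.hom.hom 2 (complexBetti.map e.ι 2 a)) := by
  obtain ⟨e, a, ha, ha0, h⟩ := exists_ksymm_hasWeilDiscriminantNondeg_powSucc_of_even hn hd hA hφ eA haA haA0 hWA hk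
  have hkn : 0 < (k + 1) * n := Nat.mul_pos (Nat.succ_pos k) hn
  refine ⟨e, a, ha, ha0, h, not_isHyperbolicWeilType_of_hasWeilDiscriminantNondeg_ne hkn
    (dim_powSucc_eq_two_mul hA k) hd (powSuccMap_comp_self_eq_neg hφ k) e ha ha0 h ?_⟩
  -- `[(-1)^{(k+1)n}] = [(-1)ⁿ]` since `k` is even
  obtain ⟨j, rfl⟩ := hk
  rwa [show (j + j + 1) * n = n + 2 * (j * n) by ring, pow_add, pow_mul, neg_one_sq, one_pow, mul_one]

/-! ## §3 The Weil classes of the powers -/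

/-- **`W_K(A^{k+1}) ⊗ ℂ ⊆ N^{(k+1)n}` as soon as `W_K(A) ⊗ ℂ ⊆ Nⁿ`** — for a complex abelian `2n`-fold `(A, φ)` (`n ≥ 1`)
with `φ ≫ φ = -(d • 𝟙 A)`, `d ≥ 1`: if the Weil plane `weilClassesOf A φ n d` consists of algebraic classes, so does the Weil
plane of every power `(A^{k+1}, φ^{k+1})` in degree `2(k+1)n` (Schoen's product step / Moonen–Zarhin (1.9)
`W_K(X^{k+1}) = W_K(X^k) ⊗_K W_K(X)`, iterated: `HodgeTheory.weilClassesOf_prod_le_algebraicClasses`). Hypothesis-free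
beyond the stated ones (no Weil type, no polarisation, no cell). [cite: Schoen1998HodgeWeilAddendum, §10]
[cite: MoonenZarhin1999LowDim, (1.9)] [cite: vanGeemen1994HodgeAV, 4.9] -/
theorem weilClassesOf_powSucc_le_algebraicClasses (hn : 0 < n) (hd : 0 < d) (hA : A.dim = 2 * n)
    (hφ : φ ≫ φ = -(d • 𝟙 A)) (h : weilClassesOf A φ n d ≤ algebraicClasses A.X n) :
    ∀ k : ℕ, weilClassesOf (A.powSucc k) (powSuccMap φ k) ((k + 1) * n) d ≤
      algebraicClasses (A.powSucc k).X ((k + 1) * n)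
  | 0 => by
    rw [powSuccMap_zero_eq, Nat.zero_add, one_mul]
    exact h
  | k + 1 => by
    rw [powSuccMap_succ_eq_powPair, show (k + 1 + 1) * n = (k + 1) * n + n by ring]
    have hkn : 0 < (k + 1) * n := Nat.mul_pos (Nat.succ_pos k) hn
    exact weilClassesOf_prod_le_algebraicClasses hkn hd (dim_powSucc_eq_two_mul hA k) hA
      (powSuccMap_comp_self_eq_neg hφ k) hφ (weilClassesOf_powSucc_le_algebraicClasses hn hd hA hφ h k) h

/-- Pointwise shape of `weilClassesOf_powSucc_le_algebraicClasses`: every class of the Weil plane of `(A^{k+1}, φ^{k+1})` —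
in particular every rational `((k+1)n, (k+1)n)` class in it — is algebraic, granted `W_K(A) ⊗ ℂ ⊆ Nⁿ`.
[cite: Schoen1998HodgeWeilAddendum, §10] [cite: MoonenZarhin1999LowDim, (1.9)] -/
theorem mem_algebraicClasses_powSucc_of_mem_weilClassesOf (hn : 0 < n) (hd : 0 < d) (hA : A.dim = 2 * n)
    (hφ : φ ≫ φ = -(d • 𝟙 A)) (h : weilClassesOf A φ n d ≤ algebraicClasses A.X n) (k : ℕ)
    {c : complexBetti (A.powSucc k).X (2 * ((k + 1) * n))}
    (hc : c ∈ weilClassesOf (A.powSucc k) (powSuccMap φ k) ((k + 1) * n) d) :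
    c ∈ algebraicClasses (A.powSucc k).X ((k + 1) * n) :=
  weilClassesOf_powSucc_le_algebraicClasses hn hd hA hφ h k hc

/-- **THE CELL `(n, d, δ)` ALONE MAKES THE WEIL CLASSES OF EVERY POWER OF EVERY WEIL-TYPE MEMBER ALGEBRAIC.** Granted
`Ring2.Hypotheses.WeilClassesComponent n d δ` (binder `hcell`; the row's own open cell, never a fact here), for every
Weil-type member `(A, φ)` of type `(n, d)` polarised by `(e, a)` with non-degenerate class `δ`, and every `k`, the Weil
plane of `(A^{k+1}, φ^{k+1})` consists of algebraic classes: the cell gives the rational `(n,n)` Weil classes of `A`, the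
balanced type `(n, n)` upgrades this to `W_K(A) ⊗ ℂ ⊆ Nⁿ` (van Geemen 4.9–4.10,
`HodgeTheory.weilClassesOf_le_algebraicClasses_of_forall_isRationalClass`), and §3 propagates it to the powers. So the
POWERS column of the census carries no open input beyond the row's own `W_K` cell, at the level of Weil classes (the
power loci on the rows `((k+1)n, d, δ^{k+1})` are covered by the BASE row `(n, d, δ)`).
[cite: vanGeemen1994HodgeAV, 4.9–4.10, Lemma 5.2 and Thm. 6.12] [cite: MoonenZarhin1999LowDim, (1.9)]
[cite: Schoen1998HodgeWeilAddendum, §10] -/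
theorem weilClassesOf_powSucc_le_algebraicClasses_of_weilClassesComponent {δ : weilNormResidueGroup d}
    (hcell : WeilClassesComponent n d δ) (hW : IsWeilType A φ n d) (eA : ProjectiveEmbedding A.X)
    {aA : complexBetti (projectiveSpace eA.n ℂ) 2} (haA : IsRationalClass aA) (haA0 : aA ≠ 0)
    (hWA : HasWeilDiscriminantNondeg A φ n d
      ((d : ℂ) • complexBetti.map eA.ι 2 aA + complexBetti.map φ.hom.hom.hom 2 (complexBetti.map eA.ι 2 aA)) δ)
    (k : ℕ) :
    weilClassesOf (A.powSucc k) (powSuccMap φ k) ((k + 1) * n) d ≤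
      algebraicClasses (A.powSucc k).X ((k + 1) * n) :=
  weilClassesOf_powSucc_le_algebraicClasses hW.pos hW.d_pos hW.dim_eq hW.sq_eq
    (weilClassesOf_le_algebraicClasses_of_forall_isRationalClass hW.pos hW.dim_eq hW.d_pos hW.sq_eq
      hW.multiplicity_eq (hcell A φ hW.dim_eq hW.isSmoothProjective hW.sq_eq eA aA haA haA0 hWA)) k

/-- **Rational `((k+1)n, (k+1)n)` Weil classes of the powers, from the cell** — the literal shape of the census rows
(`c` rational, of Hodge type `((k+1)n, (k+1)n)`, in the Weil plane of `(A^{k+1}, φ^{k+1})` ⟹ `c` algebraic), granted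
`WeilClassesComponent n d δ` for the BASE component only. [cite: vanGeemen1994HodgeAV, 4.9–4.10 and Lemma 5.2]
[cite: MoonenZarhin1999LowDim, (1.9)] -/
theorem mem_algebraicClasses_powSucc_of_weilClassesComponent {δ : weilNormResidueGroup d}
    (hcell : WeilClassesComponent n d δ) (hW : IsWeilType A φ n d) (eA : ProjectiveEmbedding A.X)
    {aA : complexBetti (projectiveSpace eA.n ℂ) 2} (haA : IsRationalClass aA) (haA0 : aA ≠ 0)
    (hWA : HasWeilDiscriminantNondeg A φ n d
      ((d : ℂ) • complexBetti.map eA.ι 2 aA + complexBetti.map φ.hom.hom.hom 2 (complexBetti.map eA.ι 2 aA)) δ)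
    (k : ℕ) {c : complexBetti (A.powSucc k).X (2 * ((k + 1) * n))}
    (hc : c ∈ weilClassesOf (A.powSucc k) (powSuccMap φ k) ((k + 1) * n) d) :
    c ∈ algebraicClasses (A.powSucc k).X ((k + 1) * n) :=
  weilClassesOf_powSucc_le_algebraicClasses_of_weilClassesComponent hcell hW eA haA haA0 hWA k hc

/-! ## §4 Even powers feed on the SPLIT rungs: `SplitEightfolds` (R2₈) and `SplitWeilAbelianVarieties` (R2) -/

/-- **THE SQUARE OF EVERY WEIL-TYPE FOURFOLD HAS ALGEBRAIC WEIL CLASSES GRANTED R2₈ `WeilTypeLadder.SplitEightfolds`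
ALONE** (binder `h8`; the split eightfold rung, OPEN, never a fact here). For `(X, φ)` of Weil type `(2, d)` carrying a
`K`-symmetrised hyperplane class of non-degenerate discriminant — of ANY class `δ`, split or not — the Weil plane of
`(X², φ²)` in degree `8` consists of algebraic classes: `X²` is a SPLIT Weil eightfold (§2), the rung gives its rational
`(4,4)` Weil classes, and hyperbolic ⟹ balanced upgrades to the complex plane
(`HodgeTheory.weilClassesOf_le_algebraicClasses_of_isHyperbolicWeilType`). Census b05.2 / b01.8.2 (P8a): «`X_a² ∈ W8.d.1`
although `X_a` is non-split». [cite: vanGeemen1994HodgeAV, Lemma 5.2, 5.4 and (5.4.1)] [cite: Markman2025SecantWeil, §1.2 (preprint)] -/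
theorem weilClassesOf_sq_fourfold_le_algebraicClasses_of_splitEightfolds (h8 : WeilTypeLadder.SplitEightfolds)
    (hW : IsWeilType A φ 2 d) (eA : ProjectiveEmbedding A.X) {aA : complexBetti (projectiveSpace eA.n ℂ) 2}
    (haA : IsRationalClass aA) (haA0 : aA ≠ 0) {δ : weilNormResidueGroup d}
    (hWA : HasWeilDiscriminantNondeg A φ 2 d
      ((d : ℂ) • complexBetti.map eA.ι 2 aA + complexBetti.map φ.hom.hom.hom 2 (complexBetti.map eA.ι 2 aA)) δ) :
    weilClassesOf (A.powSucc 1) (powSuccMap φ 1) 4 d ≤ algebraicClasses (A.powSucc 1).X 4 := by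
  have hS : IsSplitWeilType (A.powSucc 1) (powSuccMap φ 1) 4 d :=
    isSplitWeilType_powSucc_of_odd hW eA haA haA0 hWA odd_one
  obtain ⟨hW', e, a, ha, ha0, hhyp⟩ := hS
  exact weilClassesOf_le_algebraicClasses_of_isHyperbolicWeilType hW'.pos hW'.d_pos hW'.dim_eq hW'.sq_eq e ha ha0
    hhyp (h8 d hW'.d_pos _ _ hW'.dim_eq hW'.isSmoothProjective hW'.sq_eq e a ha ha0 hhyp)

/-- **EVERY EVEN POWER OF EVERY WEIL-TYPE MEMBER OF EVERY ROW (`n ≥ 2`) HAS ALGEBRAIC WEIL CLASSES GRANTED R2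
`WeilTypeLadder.SplitWeilAbelianVarieties` ALONE** (binder `h`; all split Weil-type abelian varieties of dimension
`≥ 8`, OPEN, never a fact here): for `(A, φ)` of Weil type `(n, d)`, `n ≥ 2`, with a `K`-symmetrised hyperplane class of
non-degenerate discriminant (any class) and `k` odd, the Weil plane of `(A^{k+1}, φ^{k+1})` (half-dimension
`(k+1)n ≥ 4`) consists of algebraic classes — the even-power loci sit on the SPLIT rows only (census b05.2 (P1)).
[cite: vanGeemen1994HodgeAV, Lemma 5.2, 5.4 and (5.4.1)] [cite: Markman2025SurveySecant, §12 (preprint)] -/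
theorem weilClassesOf_powSucc_le_algebraicClasses_of_splitWeilAbelianVarieties
    (h : WeilTypeLadder.SplitWeilAbelianVarieties) (hW : IsWeilType A φ n d) (hn : 2 ≤ n)
    (eA : ProjectiveEmbedding A.X) {aA : complexBetti (projectiveSpace eA.n ℂ) 2} (haA : IsRationalClass aA)
    (haA0 : aA ≠ 0) {δ : weilNormResidueGroup d}
    (hWA : HasWeilDiscriminantNondeg A φ n d
      ((d : ℂ) • complexBetti.map eA.ι 2 aA + complexBetti.map φ.hom.hom.hom 2 (complexBetti.map eA.ι 2 aA)) δ)
    {k : ℕ} (hk : Odd k) :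
    weilClassesOf (A.powSucc k) (powSuccMap φ k) ((k + 1) * n) d ≤
      algebraicClasses (A.powSucc k).X ((k + 1) * n) := by
  obtain ⟨hW', e, a, ha, ha0, hhyp⟩ := isSplitWeilType_powSucc_of_odd hW eA haA haA0 hWA hk
  have h4 : 4 ≤ (k + 1) * n := by
    obtain ⟨j, rfl⟩ := hk
    calc 4 = 2 * 2 := rfl
      _ ≤ (2 * j + 1 + 1) * n := Nat.mul_le_mul (by omega) hn
  exact weilClassesOf_le_algebraicClasses_of_isHyperbolicWeilType hW'.pos hW'.d_pos hW'.dim_eq hW'.sq_eq e ha ha0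
    hhyp (h _ h4 d hW'.d_pos _ _ hW'.dim_eq hW'.isSmoothProjective hW'.sq_eq e a ha ha0 hhyp)

/-! ## §5 Fourfolds: the Weil classes of EVERY power of EVERY Weil-type fourfold, by name -/

/-- **THE WEIL CLASSES OF EVERY POWER OF EVERY WEIL-TYPE FOURFOLD ARE ALGEBRAIC, modulo Markman's fourfold theorem**
(named fact U `HodgeTheory.Markman2025_weilClasses_algebraic_abelianFourfold`, arXiv:2502.03415 Cor. 1.6.1 / 2509.23403
Thm. 1.2 — PREPRINT, unrefereed; binder `hM`): for `(X, φ)` of Weil type `(2, d)` and every `k`, the Weil plane of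
`(X^{k+1}, φ^{k+1})` in degree `4(k+1)` consists of algebraic classes (the fact gives the rational `(2,2)` Weil classes of
`X`; balanced type upgrades to `W_K(X) ⊗ ℂ ⊆ N²`; §3). Census b05.2 (P1): the odd powers `X^{2j+1}` on the NON-split rows
`W(8j+4).d.a` and the even powers on the split rows all have algebraic WEIL classes, PREPRINT-complete, every `K`, every
class. (Nothing about the rest of the Hodge ring of `X^{k+1}`.) [cite: Markman2025SecantWeil, Cor. 1.6.1 (preprint)]
[cite: Markman2025SurveySecant, Thm. 1.2 and §11.5 Step 2 (preprint)] [cite: MoonenZarhin1999LowDim, (1.9)] -/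
theorem weilClassesOf_powSucc_fourfold_le_algebraicClasses_of_markman2025
    (hM : Markman2025_weilClasses_algebraic_abelianFourfold) (hW : IsWeilType A φ 2 d) (k : ℕ) :
    weilClassesOf (A.powSucc k) (powSuccMap φ k) ((k + 1) * 2) d ≤ algebraicClasses (A.powSucc k).X ((k + 1) * 2) :=
  weilClassesOf_powSucc_le_algebraicClasses hW.pos hW.d_pos hW.dim_eq hW.sq_eq
    (weilClassesOf_le_algebraicClasses_of_forall_isRationalClass hW.pos hW.dim_eq hW.d_pos hW.sq_eq hW.multiplicity_eq
      (hM d hW.d_pos A φ hW.dim_eq hW.isSmoothProjective hW.sq_eq)) k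

/-- **REFEREED for SPLIT fourfolds: the Weil classes of every power of every discriminant-`1` Weil fourfold are algebraic,
modulo Markman 2023** (named fact U `HodgeTheory.Markman2023_weilClasses_algebraic_discOneWeilFourfold`, JEMS 25 (2023)
Thm. 1.5 — refereed; binder `hMk`; the Weil-class part of Floccari 2026 / Floccari–Fu 2026, who prove the FULL Hodge
conjecture for these powers): for `(X, φ)` of SPLIT Weil type `(2, d)` (`HodgeTheory.IsSplitWeilType`: hyperbolic for some
`K`-symmetrised hyperplane class) and every `k`, the Weil plane of `(X^{k+1}, φ^{k+1})` consists of algebraic classes.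
[cite: Markman2023GeneralizedKummers, Theorem 1.5 (= Theorem 13.4), p. 236] [cite: FloccariFu2026, Theorem 1.2]
[cite: MoonenZarhin1999LowDim, (1.9)] -/
theorem weilClassesOf_powSucc_splitFourfold_le_algebraicClasses_of_markman2023
    (hMk : Markman2023_weilClasses_algebraic_discOneWeilFourfold) (hS : IsSplitWeilType A φ 2 d) (k : ℕ) :
    weilClassesOf (A.powSucc k) (powSuccMap φ k) ((k + 1) * 2) d ≤ algebraicClasses (A.powSucc k).X ((k + 1) * 2) := by
  obtain ⟨hW, e, a, ha, ha0, hhyp⟩ := hS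
  exact weilClassesOf_powSucc_le_algebraicClasses hW.pos hW.d_pos hW.dim_eq hW.sq_eq
    (weilClassesOf_le_algebraicClasses_of_isHyperbolicWeilType hW.pos hW.d_pos hW.dim_eq hW.sq_eq e ha ha0 hhyp
      (hMk d hW.d_pos A φ hW.dim_eq hW.isSmoothProjective hW.sq_eq e a ha ha0 hhyp)) k

end Summit.HodgeConjecture.HodgeConjecture.Ring2.WeilCoverage

end
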